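import Mathlib
import HarnessLib
import HarnessLib.Audit
import Summits.SmoothPoincare4.Statement
import Literature.Topology.FourManifolds.HomotopySpheres
import Literature.Geometry.Lorentzian.PseudoRiemannianMetric
import Literature.Geometry.Lorentzian.LeviCivita
import Literature.Geometry.Riemannian.IsotropicCurvature
import Literature.Geometry.Riemannian.RiemannianDistance
import Literature.Topology.FourManifolds.HomotopyS4CompactProofs
import Literature.Topology.FourManifolds.HomotopyS4OrientableProofs
import Literature.Geometry.Lorentzian.Volume
import HarnessLib.Audit.Status.Attr

/-!
Route: InformationMetricHadamard

DORMANT since 2026-08-23T11:49:37Z (reconciler: no traction for 6.1 d (last activity item-evidence-added at 2026-08-17T09:41:01Z); parked, not closed — `ledger route dormant route-SmoothPoincare4-InformationMetricHadamard --off` to reac) — unstaffed, not closed; items shared with open routes are served there. `ledger route dormant <id> --off` reactivates.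

# Route InformationMetricHadamard — Instanton holography pointed at SPC4 — a homotopy 4-sphere whose
information-metric bulk is Cartan–Hadamard is standard

It suffices to show X = X₂ ∧ X₃, realising card information-metric-hadamard (spine). X₂
(AhHadamardFilling): every smooth homotopy
4-sphere Σ carries a Riemannian metric g such that (Σ, g) is the conformal infinity — in the C⁰
sense of Groisser–Murray's Theorem 3.1:
a proper end collar Φ : Σ × (0,1) → W on which G ~ c (dλ² + g)/λ² uniformly as λ → 0 — of a
Cartan–Hadamard 5-manifold (W, G)
(complete, simply connected, sectional curvature ≤ 0). X₃ (C0AhRecognition): the cross-section Σ of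
such an end is diffeomorphic to S⁴.
The CANDIDATE bulk making X₂ more than a restatement is canonical: W = M₁(Σ,[g]), the charge-one
SU(2) instanton moduli space, with
Hitchin's Fisher–Rao information metric g_I, which Groisser–Murray prove complete, nondegenerate and
C⁰-asymptotically hyperbolic on the
Donaldson–Taubes collar with conformal infinity (Σ,[g]) (c = 128π²/5), and which is exactly
hyperbolic 5-space for the round class on S⁴.
The gauge-theoretic content (g_I nondegenerate in the interior, M₁ connected and simply connected,
sec(g_I) ≤ 0 for some class; the
C⁰ → C¹ upgrade of the collar asymptotics) is filed as informal cruxes under X₂/X₃ because instanton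
moduli are not yet in the tree.
Lean: `C0AhRecognition ∧ AhHadamardFilling` — both are decls of this route file (full one-line terms
under ## Cruxes); Assembly `C0AhRecognition → AhHadamardFilling → SmoothPoincare4` is proved in the
planner sketch (8 lines, via `Literature.SPC4.smoothPoincare4_of_forall_homotopySphere` and the
proved packaging facts
`Literature.Topology.FourManifolds.compactSpace_of_homotopyEquiv_sphere_four_holds` /
`isOrientable_of_homotopyEquiv_sphere_four_holds`).

## Assembly
Pure logic plus the shared packaging of the summit binder: given Σ, crux 2 supplies (g, W, G, c, Φ)
with the collar data; crux 3 applied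
to that data gives Σ ≅ S⁴; `Literature.SPC4.smoothPoincare4_of_forall_homotopySphere`
(Theorems/PICReduction.lean, proved) with the proved
facts `compactSpace_of_homotopyEquiv_sphere_four_holds` /
`isOrientable_of_homotopyEquiv_sphere_four_holds` turns "every
`HomotopySphere 4` is diffeomorphic to S⁴" into `SmoothPoincare4`. Proved in the planner sketch
(Sk/Sketch.lean, 8 lines): PROVABLE NOW.

Rationale: WHY THIS LINE. Mechanism (card information-metric-hadamard): the conformal 4-manifold (Σ,[g]) is the
boundary at infinity of the space of its own
charge-one instantons: ρ_A = |F_A|² dvol is a probability density of mass 8π², the Fisher–Rao metric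
g_I(a,b) = ∫ δ_aρ δ_bρ / ρ on
M₁(Σ,[g]) depends only on [g] (Hitchin1990; GroisserMurray1997 §2), equals real hyperbolic 5-space
for the round class (Hitchin1990,
Matumoto1989), is complete and C⁰-asymptotic to (128π²/5)(dλ² + g)/λ² on the collar
(GroisserMurray1997 Thm 3.1), and was proposed as
the AdS bulk of an arbitrary boundary metric with first-order Einstein/propagator identities
(BlauNarainThompson2001 §§2–4; BianchiEtAl1998
for the S⁴ dictionary). Nobody asked what this bulk knows about the SMOOTH structure of its
boundary; the recognition engine imported here
is comparison geometry of nonpositive curvature: in a Cartan–Hadamard manifold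
(LeeRiemannianManifolds2018 Thm 12.8) a compact convex body
with smooth boundary has boundary diffeomorphic to the sphere (radial projection from an interior
point is a diffeomorphism), so if the
far collar slices {λ = ε} ≅ Σ bound convex regions of (M₁, g_I), then Σ ≅ S⁴ — no curvature
hypothesis on Σ, no flow, no surgery, no
value of any invariant. Imported areas: information geometry (Fisher–Rao curvature of deformed
location–scale families, AmariNagaoka2007),
asymptotically hyperbolic geometry (geodesic compactification and its regularity, Bahuaud2009,
BahuaudGicquaud2010), Hadamard-manifold
convexity (EberleinOneill1973). Versus prior routes: PIC/LCF ask curvature conditions ON Σ; here the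
condition lives on a canonical
5-dimensional filling and is a SIGN (sec ≤ 0) plus π₀ = π₁ = 0; versus the sibling card
instanton-entropy-mountain-pass (same platform
M₁, a FUNCTION and Morse theory) this line uses a METRIC and synthetic convexity; negatives index
empty at filing.

RANKED CRUXES. #2 AhHadamardFilling (crux) — every homotopy 4-sphere Σ admits a Riemannian metric g,
a Cartan–Hadamard 5-manifold (W, G) (complete: closed distance balls compact; simply connected; sec
≤ 0 for the Levi-Civita connection), a constant c > 0 and a proper end collar Φ : Σ × (0,1) → W
(smooth and injective on Σ × (0,1), far parts Φ(Σ × (0,t)) co-compact with closure inside the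
collar) on which G is C⁰-asymptotic to c(dλ² + g)/λ²: for every ε > 0, |G(dΦ(v,s), dΦ(v,s)) − c(s² +
g(v,v))/λ²| ≤ ε·c(s² + g(v,v))/λ² for λ small. Intended witness (card K1+K2 + GM fact): W =
M₁(Σ,[g]), G = g_I, c = 128π²/5, Φ = Donaldson–Taubes collar. [difficulty: open-problem] (why it
might fail: Given crux 3 it is SPC4-strength on fillable Σ; the one candidate (M₁(Σ,[g]), g_I) needs
sec ≤ 0, interior nondegeneracy (GM §2 leave it open) and π₀ = π₁ = 0 of M₁, all unknown off the
round class, and conformally round classes give no test (g_I depends on [g] only).)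
[GroisserMurray1997, Hitchin1990, BlauNarainThompson2001, Taubes1982, Donaldson1983,
FreedUhlenbeck1984, Taubes1984, Matumoto1989]
#3 C0AhRecognition (crux) — if a homotopy 4-sphere Σ, with any Riemannian metric g, is the
cross-section of a proper end collar of a Cartan–Hadamard 5-manifold (W, G) on which G is
C⁰-asymptotic to c(dλ² + g)/λ² (exactly the data of crux 2), then Σ is diffeomorphic to S⁴. This
isolates the regularity gap between Groisser–Murray's C⁰ theorem and what recognition needs (card
K3). [difficulty: L] (why it might fail: C⁰ control of G gives no C¹ control at infinity: the collar
compactification and the geodesic one (Bahuaud–Gicquaud need curvature decay AH0–AH1 for a C^{1,a}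
structure) may agree only topologically, giving Σ ≈ S⁴ merely homeomorphically (Freedman, no gain);
provable forms need convex far slices.) [GroisserMurray1997, Bahuaud2009, BahuaudGicquaud2010,
EberleinOneill1973, LeeRiemannianManifolds2018]
#9 HadamardConvexBoundarySphere (support) — recognition engine (Cartan–Hadamard + convexity, a
theorem to be formalised): in a complete simply connected Riemannian 5-manifold with sectional
curvature ≤ 0, a compact set C with nonempty interior which is convex (betweenness form: d(p,m) +
d(m,q) = d(p,q) with p, q ∈ C forces m ∈ C — equivalent to geodesic convexity since geodesics are
unique) and whose frontier is the image of an injective immersion of a compact smooth 4-manifold N,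
has N ≅ S⁴. Proof: exp_o from an interior point o is a diffeomorphism (Lee Thm 12.8/Prop 12.9); each
ray from o leaves C exactly once (convexity + compactness) and transversally (C lies on one side of
its smooth frontier; a tangential exit direction would put interior points on both sides), so radial
projection frontier C → unit sphere of T_oW is a bijective local diffeomorphism of compact
4-manifolds. [difficulty: L] [LeeRiemannianManifolds2018, EberleinOneill1973]
#9 ConvexEndRecognition (support) — the convex-slice form of crux 3, provable from
HadamardConvexBoundarySphere by bookkeeping (it is the glue of the foreseen split of crux 3 and the
landing point of the gauge-side C¹ upgrade AhC1ConvexSlices): if Σ is the cross-section of a proper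
smooth injective immersive end collar Φ of a Cartan–Hadamard 5-manifold and for some t the
complement K_t of the far collar Φ(Σ × (0,t)) has nonempty interior and is convex, then Σ ≅ S⁴
(frontier K_t = Φ(Σ × {t}) ≅ Σ by the closure condition on the collar). [difficulty: M]
[LeeRiemannianManifolds2018, GroisserMurray1997]

TWO-LAYER PLAN. Foreseen splits (nothing filed now beyond the two informal gauge cruxes): (a)
AhHadamardFilling ⇐ [fact GM Thm 3.1 + Taubes/Donaldson/
Freed–Uhlenbeck collar package] → InformationMetricHadamard (informal crux, rank 4: ∃[g] with g_I
nondegenerate and complete on M₁(Σ,[g]),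
M₁ connected and simply connected, sec(g_I) ≤ 0) → AhHadamardFilling, glue = unpacking definitions
once `asdInstantonModuliSpace` /
`fisherRaoMetric` land. (b) C0AhRecognition ⇐ C0AhConvexEnd (a C⁰-asymptotically-hyperbolic end of a
Cartan–Hadamard 5-manifold has SOME
far region K_t that is convex with nonempty interior) → ConvexEndRecognition (support, filed) →
C0AhRecognition, glue = pure logic; the
gauge-side alternative to C0AhConvexEnd is AhC1ConvexSlices (informal crux, rank 5: the
C¹/curvature-decay upgrade of GM Thm 3.1 making
the slices {λ = ε} themselves g_I-convex), after which crux 3 is no longer needed for the instanton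
witness. (c) HadamardConvexBoundarySphere
⇐ CartanHadamardExp (exp_o is a diffeomorphism; vendorable fact, Lee Thm 12.8) → RadialGraphLemma
(one-sided smooth frontier of a convex
body is transverse to rays) → HadamardConvexBoundarySphere.

KILL CRITERIA. Refuting AhHadamardFilling or C0AhRecognition as typed is equivalent to exhibiting an
exotic 4-sphere (both follow from SPC4: hyperbolic
5-space in geodesic polar coordinates λ = 2e^{−r} is the model witness), so the route is closed
`refuted:` only together with the summit.
The LINE dies earlier if: (i) a theorem "sec(g_I) > 0 somewhere on M₁(S⁴,[g]) for every
non-conformally-flat [g]" appears — then the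
instanton witness of crux 2 needs [g] locally conformally flat and the route collapses onto PIC crux
PicConformallyFlatV2 (close
`superseded --by route-SmoothPoincare4-PIC`); (ii) g_I is shown degenerate somewhere in the interior
of M₁ for generic metrics on b₂ = 0
manifolds (GM §2 scenario) with no conformal cure — pivot to the nondegenerate quotient or to the
L²/entropy siblings; (iii) M₁(S⁴, g)
disconnected or non-simply-connected for an open set of metrics — InformationMetricHadamard restated
"for [g] near conformally flat";
(iv) a C⁰-AH Cartan–Hadamard end over S⁴ with no convex far region and non-immersive radial
projections is constructed — the METHOD
behind crux 3 fails at C⁰ and the pair (2,3) is restated at C¹/convex-slice regularity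
(AhC1ConvexSlices load-bearing). Mooted if PIC's
LCF crux or any sibling M₁-route closes SPC4 first.

NOT DECOMPOSED YET. Deliberately not filed: the gauge facts as Lean hypotheses (Taubes existence,
Uhlenbeck compactness/collar, Freed–Uhlenbeck genericity,
GM Thm 3.1, Hitchin's S⁴ computation) — requested as cite items and definition requests, they become
`(h : Fact) →` binders of the
children in split (a) once `asdInstantonModuliSpace` exists; the local-to-global convexity lemma
(connected compact set with smooth
locally convex boundary in a Hadamard manifold is convex) and the Cartan–Hadamard exponential-map
fact behind HadamardConvexBoundarySphere
(split (c)); the BUSEMANN identity (log ρ_A + 4B bounded) and the Poincaré–Einstein second engine of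
the card (NearEinstein + small Weyl
energy ⇒ PE gap rigidity) — a separate route if BNT's first-order Einstein property is ever pushed
to all orders; OPENNESS near the round
class (true, uninformative as an item); regime splits by conformal class.

CHEAPEST FALSIFIER. Compute, do not argue: take the cohomogeneity-one squashed 4-spheres (S⁴, g_a)
(SO(4)- or U(2)-invariant, one squashing parameter a),
reduce the charge-one ASD equation to ODEs, and evaluate the information metric g_I and its
sectional curvatures along the invariant
2-dimensional slice of M₁ (centre on the symmetry axis × scale) numerically (kit job; interval
arithmetic for the sign). A positively
curved 2-plane persisting for all a ≠ 0 near 0 kills "sec(g_I) ≤ 0 for all [g]" and, if it persists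
for every non-conformally-flat
class tested, triggers kill criterion (i). Second, cheaper still: push Blau–Narain–Thompson's
first-order computation (g_I Einstein to
first order around the round class) to SECOND order in a single non-conformal harmonic direction and
read off the sign of the curvature
correction at an interior point — a hand/computer-algebra computation from GM's formula ((metric1))
that either exhibits positive
curvature at order 2 (bad sign generic) or confirms non-positivity to that order. Neither was run
this session (no instanton ODE code in
kit yet; recorded as the first refuter task).

NUMBERS. c = 128π²/5: g_I ~ (128π²/5)(dλ² + g)/λ² on the collar, C⁰ sense, charge one, SU(2), closed
simply connected positive-definite M
(GroisserMurray1997 Thm 3.1 and Conditions 3.0 — a homotopy 4-sphere qualifies vacuously, H² = 0);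
model sectional curvatures → −5/(128π²);
instanton mass ∫|F_A|² = 8π²; dim M₁ = 8k − 3(1 − b₁ + b⁺) = 5; (M₁(S⁴,[g₀]), g_I) = real hyperbolic
5-space up to scale (Hitchin1990;
GroisserMurray1997 §2; Matumoto1989); BNT: g_I Einstein, ρ the massless bulk-to-boundary propagator
and log ρ the regularised geodesic
distance, all to FIRST order around the round class, and not all three can hold at second order
(BlauNarainThompson2001 pp. 3–4);
Bahuaud–Gicquaud: |Rm − Rm_const| + |∇Rm| = O(e^{−ar}) outside an essential subset gives a C^{1,a}
(a < 1) / C^{1,1} (a > 1) geodesic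
compactification (BahuaudGicquaud2010 Thm 1).

DEFINITION REQUESTS. D1 `fisherRaoMetric` (topic Literature/InformationTheory): the Fisher–Rao
information metric of a smooth finite-dimensional family of
positive probability densities p ↦ ρ_p on a measure space, g_I(a,b) = ∫ (∂_aρ)(∂_bρ)/ρ dμ, with its
invariance under sufficient statistics /
push-forward by diffeomorphisms — small, Mathlib-near (measure theory + mfderiv). D2
`asdInstantonModuliSpace` (topic
Literature/Geometry/GaugeTheory): the moduli space of anti-self-dual connections of charge k on the
principal SU(2)-bundle over a closed
oriented Riemannian 4-manifold modulo gauge, as a topological space with its smooth structure on the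
irreducible locus for generic metrics
(Freed–Uhlenbeck), plus the instanton density map A ↦ |F_A|² dvol — XL, the honest blocker for
typing the gauge cruxes; until it lands they
stay informal. Cite facts wanted (filed as cite items): GM Thm 3.1; Hitchin's hyperbolic S⁴
computation; Cartan–Hadamard (Lee 2018 Thm
12.8); the Taubes1982/Donaldson1983/FreedUhlenbeck1984 collar package for b⁺ = 0, k = 1; Taubes1984
path-connectedness of M_k(S⁴).

Novelty: Searches (2026-08-15): `lit read arxiv:dg-ga/9611008` (GM: Thm 3.1 p.6, Conditions 3.0, §2
degeneracy remark — read), `lit read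
arxiv:hep-th/0108122` (BNT pp. 3–6 — read), `lit read book:lee2018-introduction-riemannian-manifolds
--grep Cartan.Hadamard` (Thm 12.8
p. 352, Prop 12.9, Lemma 12.15 — read), `lit search --source crossref "information metric instanton
moduli space curvature"` (12 rows:
Yahikozawa 2004 PRE nonlinear-sigma-model analogue, Matumoto 1988/89, Habermann 1993 L² metric,
nothing topological), `lit search
--source crossref "star-shaped hypersurfaces Hadamard manifold"` (curvature-flow papers only), `lit
search --source crossref "conformally
compact asymptotically hyperbolic geodesic compactification boundary"` (→ BahuaudGicquaud2010, read
arXiv:0811.4184 pp. 2, 4: Thm 1.1,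
Thms 1–3; Bahuaud2009), `lit search --source crossref "Fisher information metric negative curvature
location scale family hyperbolic"`
(noise), `lit frontier SmoothPoincare4 --since 2020` (30 rows, none on moduli-space geometry), `lit
bridges SmoothPoincare4 --cross any`
(none relevant), `lit galaxy search … --star all` ×2 (galaxyd congested, 0 rows — OWED: "information
metric on the moduli space of
instantons", "Cartan-Hadamard manifold conformally compact"), `ledger idea list` (129 cards;
siblings instanton-entropy-mountain-pass
open, instanton-moduli-ball-half-pic retired), `ledger negatives` (0). searchd local index and
OpenAlex/S2 were down/rate-limited all
session. The card's own audi  [refs: 10.1023/a:1006560802410, 10.1007/s12220-010-9179-3:, dg-ga/9611008, hep-th/0108122, 0811.4184, arxiv:dg-ga/9611008, arxiv:hep-th/0108122, book:lee2018-introduction-riemannian-manifolds, doi:10.1023/a, doi:10.1007/s12220-010-9179-3, BahuaudGicquaud2010, Bahuaud2009, Matumoto1989, ItohSatoh2011, BlauNarainThompson2001, GroisserMurray1997, Hitchin1990]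

Barriers (technique_class: instanton moduli; information metric; Cartan-Hadamard): - technique_class: instanton moduli; information metric; Cartan-Hadamard
- Literature.Barriers.SmoothPoincare4.GaugeSumBarrierFour: evaded by kind — no value of a
gauge-theoretic invariant is compared across manifolds; the moduli space enters as a Riemannian
filling in the b⁺ = 0, k = 1 regime where moduli GEOMETRY (not a number) does constrain smooth
structure (Donaldson1983-type use).
- Literature.Barriers.SmoothPoincare4.HCobordismBarrierFour: acknowledged — the region of M₁ between
a small geodesic sphere (≅ S⁴) and a far collar slice (≅ Σ) IS an h-cobordism; it is trivialised by
a specific geometric reason (radial projection from an interior point of a convex body is a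
diffeomorphism in nonpositive curvature), never by the general h-cobordism principle.
- Literature.Barriers.SmoothPoincare4.HCobordismInvariantBarrierFour: not applicable — nothing
factors through smooth h-cobordism classes.
- Literature.Barriers.SmoothPoincare4.StableBarrierFour: not applicable — no stabilisation; (M₁,
g_I) of Σ # S²×S² is a different (higher-b⁺, reducible-laden) object.
- Literature.Barriers.SmoothPoincare4.TopologicalBarrierFour: not applicable — (M₁(Σ,[g]), g_I)
depends on the smooth conformal structure; the conclusion is a diffeomorphism produced by exp and
radial projection, not a homeomorphism invariant.
- Literature.Barriers.SmoothPoincare4.CircleActionBarrierFour: the warning applies — Hitchin's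
identification with ℍ⁵ is pure SO(5,1) symmetry and for an unknown Σ there is none; he

History (route lifecycle, newest last):
- 2026-08-23T11:49:37Z · DORMANT — reconciler: no traction for 6.1 d (last activity item-evidence-added at 2026-08-17T09:41:01Z); parked, not closed — `ledger route dormant route-SmoothPoincare4- (operator:999:1061261)

sub-problem: SmoothPoincare4 · status: dormant · opened planner-plancard-SmoothPoincare4-SmoothPoinca-50dcada7-0 2026-08-15T11:43:54Z · rev 5 · ledger route-SmoothPoincare4-InformationMetricHadamard
GENERATED by the gate from the ledger (D-0016/17). Provers cite these decls: `theorem foo : Summit.SmoothPoincare4.SmoothPoincare4.Theses.InformationMetricHadamard.<Decl> := …` in Summits/SmoothPoincare4/SmoothPoincare4/Theorems/<Name>.lean.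
-/

namespace Summit.SmoothPoincare4.SmoothPoincare4.Theses.InformationMetricHadamard

open scoped BigOperators Topology Manifold Classical MeasureTheory ProbabilityTheory Matrix InnerProductSpace ComplexConjugate ContinuousMap ContDiff
open Filter Set Function TopologicalSpace MeasureTheory

attribute [summit_statement] _root_.SmoothPoincare4

open Literature.SPC4

/-- item stmt-SmoothPoincare4-6014 · crux · rank 2 · open · by planner
why it might fail: Given crux 3 it is SPC4-strength on fillable Σ; the one candidate (M₁(Σ,[g]), g_I) needs sec ≤ 0, interior nondegeneracy (GM §2 leave it open) and π₀ = π₁ = 0 of M₁, all unknown off the round class, and conformally round classes give no test (g_I depends on [g] only).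
sources: GroisserMurray1997, Hitchin1990, BlauNarainThompson2001, Taubes1982, Donaldson1983, FreedUhlenbeck1984
[crux] every homotopy 4-sphere Σ admits a Riemannian metric g, a Cartan–Hadamard 5-manifold (W, G)
(complete: closed distance balls compact; simply connected; sec ≤ 0 for the Levi-Civita connection),
a constant c > 0 and a proper end collar Φ : Σ × (0,1) → W (smooth and injective on Σ × (0,1), far
parts Φ(Σ × (0,t)) co-compact with closure inside the collar) on which G is C⁰-asymptotic to c(dλ² +
g)/λ²: for every ε > 0, |G(dΦ(v,s), dΦ(v,s)) − c(s² + g(v,v))/λ²| ≤ ε·c(s² + g(v,v))/λ² for λ small.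
Intended witness (card K1+K2 + GM fact): W = M₁(Σ,[g]), G = g_I, c = 128π²/5, Φ = Donaldson–Taubes
collar. [difficulty: open-problem] -/
@[route_item "route-SmoothPoincare4-InformationMetricHadamard", crux]
def AhHadamardFilling : Prop :=
  ∀ (S : Literature.Topology.FourManifolds.HomotopySphere 4), ∃ (g : Literature.Geometry.Lorentzian.PseudoRiemannianMetric (𝓡 4) ∞ (EuclideanSpace ℝ (Fin 4)) (TangentSpace (𝓡 4) : S.carrier → Type _)) (_ : g.IsRiemannian) (W : Type) (_ : TopologicalSpace W) (_ : T2Space W) (_ : SecondCountableTopology W) (_ : ChartedSpace (EuclideanSpace ℝ (Fin 5)) W) (_ : IsManifold (𝓡 5) ∞ W) (_ : SimplyConnectedSpace W) (G : Literature.Geometry.Lorentzian.PseudoRiemannianMetric (𝓡 5) ∞ (EuclideanSpace ℝ (Fin 5)) (TangentSpace (𝓡 5) : W → Type _)) (hG : G.IsRiemannian) (c : ℝ) (Φ : S.carrier × ℝ → W), 0 < c ∧ (∀ (x : W) (r : NNReal), IsCompact {y : W | G.edist hG x y ≤ r}) ∧ (∀ cov, G.IsLeviCivita cov → ∀ (x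 : W) (X Y : TangentSpace (𝓡 5) x), G.sectionalCurvature cov x X Y ≤ 0) ∧ ContMDiffOn ((𝓡 4).prod 𝓘(ℝ, ℝ)) (𝓡 5) ∞ Φ (Set.univ ×ˢ Set.Ioo (0 : ℝ) 1) ∧ Set.InjOn Φ (Set.univ ×ˢ Set.Ioo (0 : ℝ) 1) ∧ (∀ t ∈ Set.Ioo (0 : ℝ) 1, IsCompact (Φ '' (Set.univ ×ˢ Set.Ioo (0 : ℝ) t))ᶜ) ∧ (∀ t ∈ Set.Ioo (0 : ℝ) 1, closure (Φ '' (Set.univ ×ˢ Set.Ioo (0 : ℝ) t)) ⊆ Φ '' (Set.univ ×ˢ Set.Ioo (0 : ℝ) 1)) ∧ (∀ ε : ℝ, 0 < ε → ∃ t ∈ Set.Ioo (0 : ℝ) 1, ∀ (x : S.carrier) (l : ℝ), l ∈ Set.Ioo (0 : ℝ) t → ∀ (v : TangentSpace (𝓡 4) x) (s : ℝ), |G.val (Φ (x, l)) (mfderiv ((𝓡 4).prod 𝓘(ℝ, ℝ)) (𝓡 5) Φ (x, l) (v, s)) (mfderiv ((𝓡 4).prod 𝓘(ℝ, ℝ))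 (𝓡 5) Φ (x, l) (v, s)) - c * (s ^ 2 + g.val x v v) / l ^ 2| ≤ ε * (c * (s ^ 2 + g.val x v v) / l ^ 2))

/-- item stmt-SmoothPoincare4-6015 · crux · rank 3 · closed · proved by Summit.SmoothPoincare4.SmoothPoincare4.Cruxes.C0AhRecognition.CoreDistanceMorse.C0AhRecognition_of @ 187922d383b9 (prover) · by planner
why it might fail: C⁰ control of G gives no C¹ control at infinity: the collar compactification and the geodesic one (Bahuaud–Gicquaud need curvature decay AH0–AH1 for a C^{1,a} structure) may agree only topologically, giving Σ ≈ S⁴ merely homeomorphically (Freedman, no gain); provable forms need convex far slices.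
sources: GroisserMurray1997, Bahuaud2009, BahuaudGicquaud2010, EberleinOneill1973, LeeRiemannianManifolds2018
[crux] if a homotopy 4-sphere Σ, with any Riemannian metric g, is the cross-section of a proper end
collar of a Cartan–Hadamard 5-manifold (W, G) on which G is C⁰-asymptotic to c(dλ² + g)/λ² (exactly
the data of crux 2), then Σ is diffeomorphic to S⁴. This isolates the regularity gap between
Groisser–Murray's C⁰ theorem and what recognition needs (card K3). [difficulty: L] -/
@[route_item "route-SmoothPoincare4-InformationMetricHadamard", crux]
def C0AhRecognition : Prop :=
  ∀ (S : Literature.Topology.FourManifolds.HomotopySphere 4) (g : Literature.Geometry.Lorentzian.PseudoRiemannianMetric (𝓡 4) ∞ (EuclideanSpace ℝ (Fin 4)) (TangentSpace (𝓡 4) : S.carrier → Type _)), g.IsRiemannian → ∀ (W : Type) [TopologicalSpace W] [T2Space W] [SecondCountableTopology W] [ChartedSpace (EuclideanSpace ℝ (Fin 5)) W] [IsManifold (𝓡 5) ∞ W] [SimplyConnectedSpace W] (G : Literature.Geometry.Lorentzian.PseudoRiemannianMetric (𝓡 5) ∞ (EuclideanSpace ℝ (Fin 5)) (TangentSpace (𝓡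 5) : W → Type _)) (hG : G.IsRiemannian) (c : ℝ) (Φ : S.carrier × ℝ → W), 0 < c → (∀ (x : W) (r : NNReal), IsCompact {y : W | G.edist hG x y ≤ r}) → (∀ cov, G.IsLeviCivita cov → ∀ (x : W) (X Y : TangentSpace (𝓡 5) x), G.sectionalCurvature cov x X Y ≤ 0) → ContMDiffOn ((𝓡 4).prod 𝓘(ℝ, ℝ)) (𝓡 5) ∞ Φ (Set.univ ×ˢ Set.Ioo (0 : ℝ) 1) → Set.InjOn Φ (Set.univ ×ˢ Set.Ioo (0 : ℝ) 1) → (∀ t ∈ Set.Ioo (0 : ℝ) 1, IsCompact (Φ '' (Set.univ ×ˢ Set.Ioo (0 : ℝ) t))ᶜ) → (∀ t ∈ Set.Ioo (0 : ℝ) 1, closure (Φ '' (Set.univ ×ˢ Set.Ioo (0 : ℝ) t)) ⊆ Φ '' (Set.univ ×ˢ Set.Ioo (0 : ℝ) 1)) → (∀ ε : ℝ, 0 < ε → ∃ t ∈ Set.Ioo (0 : ℝ) 1, ∀ (x : S.carrier) (l : ℝ), l ∈ Set.Ioo (0 : ℝ) t → ∀ (v : TangentSpace (𝓡 4) x) (s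 : ℝ), |G.val (Φ (x, l)) (mfderiv ((𝓡 4).prod 𝓘(ℝ, ℝ)) (𝓡 5) Φ (x, l) (v, s)) (mfderiv ((𝓡 4).prod 𝓘(ℝ, ℝ)) (𝓡 5) Φ (x, l) (v, s)) - c * (s ^ 2 + g.val x v v) / l ^ 2| ≤ ε * (c * (s ^ 2 + g.val x v v) / l ^ 2)) → Nonempty (S.carrier ≃ₘ⟮𝓡 4, 𝓡 4⟯ Metric.sphere (0 : EuclideanSpace ℝ (Fin 5)) 1)

/-- item stmt-SmoothPoincare4-7998 · crux · rank 4 · open · by planner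
why it might fail: A strict consequence of SPC4 with no independent mechanism: false iff some homotopy 4-sphere is Yamabe-thin; σ is uncomputable on candidates, surgery monotonicity (Kobayashi, Petean–Yun, ADH 2013) loses control at the codimension-2 step, and σ(S²×S²) =? σ₄ is open.
sources: Kobayashi1987, Schoen1989, AmmannDahlHumbert2013, arXiv:0804.1418, Aubin1976
[crux] Y1 (card step 3; shared with card yamabe-extremal-or-thin): every closed smooth M ≃ₕ S⁴ is
Yamabe-extremal, σ(M) = sup_[g] Y(M,[g]) = Y(S⁴): for every η > 0 there is a metric g₀ with ∫_M R_h
dV_h ≥ (1−η)·8√6π·√Vol(M,h) for every metric h conformal to g₀. [difficulty: open-problem] -/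
@[route_item "route-SmoothPoincare4-InformationMetricHadamard", crux]
def YamabeExtremalSpheres : Prop :=
  ∀ (M : Type) [TopologicalSpace M] [T2Space M] [SecondCountableTopology M] [ChartedSpace (EuclideanSpace ℝ (Fin 4)) M] [IsManifold (𝓡 4) ∞ M] [CompactSpace M] [MeasurableSpace M] [BorelSpace M], M ≃ₕ Metric.sphere (0 : EuclideanSpace ℝ (Fin 5)) 1 → ∀ η : ℝ, 0 < η → ∃ g₀ : Bundle.ContMDiffRiemannianMetric (𝓡 4) ∞ (EuclideanSpace ℝ (Fin 4)) (TangentSpace (𝓡 4) : M → Type _), (∀ (h' : Bundle.ContMDiffRiemannianMetric (𝓡 4) ∞ (EuclideanSpace ℝ (Fin 4)) (TangentSpace (𝓡 4) : M → Type _)) [(Literature.Geometry.Lorentzian.PseudoRiemannianMetric.ofRiemannian h').HasLeviCivita], (∃ φ : M → ℝ, ∀ x : M, 0 < φ x ∧ ∀ v w : TangentSpace (𝓡 4) x, h'.inner x v w = φ x * g₀.inner x v w) → (1 - η) * (8 * Real.sqrt 6 * Real.pi) * Real.sqrt ((Literature.Geometry.Lorentzian.riemannianMeasure h' Set.univ).toReal)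 ≤ ∫ x, (Literature.Geometry.Lorentzian.PseudoRiemannianMetric.ofRiemannian h').scalarCurvature x ∂(Literature.Geometry.Lorentzian.riemannianMeasure h'))

/-- item stmt-SmoothPoincare4-7997 · crux · rank 5 · open · by planner
why it might fail: On S⁴: large-data PE existence is open even on B⁵ (Graham–Lee/Lee are perturbative); a near-round dumbbell class bounding no PE⁵ kills it. On exotic M it says exactly 'exotic spheres are δ-Yamabe-thin' (GAP), for which no mechanism exists.
sources: GrahamLee1991, Lee2006, Anderson2008, GurskySzekelyhidi2020, LiQingShi2017
[crux] PE-FILL(δ) on homotopy 4-spheres (card step 3, the load-bearing conjecture): there is δ > 0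
such that for every closed smooth M ≃ₕ S⁴ and every metric g₀ on M with Y(M,[g₀]) ≥ (1−δ)·8√6π there
is a conformally compact Einstein 5-manifold (N, g), Ric = −4g, with C² compactification X̄, ∂X̄ =
M, |dρ|_ḡ = 1 on ∂X̄ and conformal infinity [g₀]. [deps: YamabePinchedEinsteinBulk] [difficulty:
open-problem] -/
@[route_item "route-SmoothPoincare4-InformationMetricHadamard", crux]
def PEFillNearRound : Prop :=
  ∃ δ : ℝ, 0 < δ ∧ ∀ (M : Type) [TopologicalSpace M] [T2Space M] [SecondCountableTopology M] [ChartedSpace (EuclideanSpace ℝ (Fin 4)) M] [IsManifold (𝓡 4) ∞ M] [CompactSpace M] [ConnectedSpace M] [MeasurableSpace M] [BorelSpace M], M ≃ₕ Metric.sphere (0 : EuclideanSpace ℝ (Fin 5)) 1 → ∀ (g₀ : Bundle.ContMDiffRiemannianMetric (𝓡 4) ∞ (EuclideanSpace ℝ (Fin 4)) (TangentSpace (𝓡 4) : M → Type _)), (∀ (h' : Bundle.ContMDiffRiemannianMetric (𝓡 4) ∞ (EuclideanSpace ℝ (Fin 4)) (TangentSpace (𝓡 4) : M → Type _)) [(Literature.Geometry.Lorentzian.PseudoRiemannianMetric.ofRiemannian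 h').HasLeviCivita], (∃ φ : M → ℝ, ∀ x : M, 0 < φ x ∧ ∀ v w : TangentSpace (𝓡 4) x, h'.inner x v w = φ x * g₀.inner x v w) → (1 - δ) * (8 * Real.sqrt 6 * Real.pi) * Real.sqrt ((Literature.Geometry.Lorentzian.riemannianMeasure h' Set.univ).toReal) ≤ ∫ x, (Literature.Geometry.Lorentzian.PseudoRiemannianMetric.ofRiemannian h').scalarCurvature x ∂(Literature.Geometry.Lorentzian.riemannianMeasure h')) → ∃ (N : Type) (_ : TopologicalSpace N) (_ : T2Space N) (_ : SecondCountableTopology N) (_ : ChartedSpace (EuclideanSpace ℝ (Fin 5)) N) (_ : IsManifold (𝓡 5) ∞ N) (g : Bundle.ContMDiffRiemannianMetric (𝓡 5) ∞ (EuclideanSpace ℝ (Fin 5)) (TangentSpace (𝓡 5) : N → Type _)) (_ : (Literature.Geometry.Lorentzian.PseudoRiemannianMetric.ofRiemannian g).HasLeviCivita), (∀ x, (Literature.Geometry.Lorentzian.PseudoRiemannianMetric.ofRiemannian g).ricci x = (-4 : ℝ) • (Literature.Geometry.Lorentzian.PseudoRiemannianMetric.ofRiemannian g).toBilinForm x)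 ∧ (∃ (X : Type) (_ : TopologicalSpace X) (_ : T2Space X) (_ : SecondCountableTopology X) (_ : ChartedSpace (EuclideanHalfSpace 5) X) (_ : IsManifold (𝓡∂ 5) ∞ X) (_ : CompactSpace X) (_ : ConnectedSpace X) (j : N → X) (ι : M → X) (ρ : X → ℝ) (gb : Bundle.ContMDiffRiemannianMetric (𝓡∂ 5) 2 (EuclideanSpace ℝ (Fin 5)) (TangentSpace (𝓡∂ 5) : X → Type _)), Manifold.IsSmoothEmbedding (𝓡 5) (𝓡∂ 5) ∞ j ∧ Set.range j = (𝓡∂ 5).interior X ∧ Manifold.IsSmoothEmbedding (𝓡 4) (𝓡∂ 5) ∞ ι ∧ Set.range ι = (𝓡∂ 5).boundary X ∧ ContMDiff (𝓡∂ 5) 𝓘(ℝ, ℝ) ∞ ρ ∧ (∀ x : X, 0 ≤ ρ x) ∧ (∀ x : X, ρ x = 0 ↔ x ∈ (𝓡∂ 5).boundary X) ∧ (∀ y : M, ∃ ν : TangentSpace (𝓡∂ 5) (ι y), gb.inner (ι y) ν ν = 1 ∧ ∀ v : TangentSpace (𝓡∂ 5) (ι y), gb.inner (ι y) ν v = mfderiv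 (𝓡∂ 5) 𝓘(ℝ, ℝ) ρ (ι y) v) ∧ (∀ (x : N) (v w : TangentSpace (𝓡 5) x), gb.inner (j x) (mfderiv (𝓡 5) (𝓡∂ 5) j x v) (mfderiv (𝓡 5) (𝓡∂ 5) j x w) = ρ (j x) ^ 2 * g.inner x v w) ∧ (∃ φ : M → ℝ, ∀ y : M, 0 < φ y ∧ ∀ v w : TangentSpace (𝓡 4) y, gb.inner (ι y) (mfderiv (𝓡 4) (𝓡∂ 5) ι y v) (mfderiv (𝓡 4) (𝓡∂ 5) ι y w) = φ y * g₀.inner y v w))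

/-- item stmt-SmoothPoincare4-7996 · crux · rank 6 · open · by planner
why it might fail: Published theorem (Trans. AMS 369, 2017, Thm 1.8; arXiv:1410.6402 p.4); risk is transcription only: Ric = −(n−1)g with n = 5, C² compactification (their Def 2.1), Yamabe in the metric form with Y(S⁴) = 8√6π; δ(ε) ineffective.
sources: LiQingShi2017, arXiv:1410.6402, doi:10.1090/tran/6925, LeeParker1987
[crux] NAMED FACT (LiQingShi2017 Thm 1.8 at n = 5, filed first per the cone rule, to be vendored in
Literature and threaded as a hypothesis): for every ε > 0 there is δ > 0 such that every conformally
compact Einstein 5-manifold (N, g), Ric_g = −4g, with C² compactification X̄ (compact, connected,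
∂X̄ = M closed connected, smooth bdf ρ with |dρ|_ḡ = 1 on ∂X̄) whose conformal infinity (M,[g₀]) has
Y(M,[g₀]) ≥ (1−δ)·8√6π, satisfies |K + 1| ≤ ε for every sectional curvature K of g (orthonormal
2-frames). [difficulty: XL] -/
@[route_item "route-SmoothPoincare4-InformationMetricHadamard", crux]
def YamabePinchedEinsteinBulk : Prop :=
  ∀ ε : ℝ, 0 < ε → ∃ δ : ℝ, 0 < δ ∧ ∀ (M : Type) [TopologicalSpace M] [T2Space M] [SecondCountableTopology M] [ChartedSpace (EuclideanSpace ℝ (Fin 4)) M] [IsManifold (𝓡 4) ∞ M] [CompactSpace M] [ConnectedSpace M] [MeasurableSpace M] [BorelSpace M] (g₀ : Bundle.ContMDiffRiemannianMetric (𝓡 4) ∞ (EuclideanSpace ℝ (Fin 4)) (TangentSpace (𝓡 4) : M → Type _)) (N : Type) [TopologicalSpace N] [T2Space N] [SecondCountableTopology N] [ChartedSpace (EuclideanSpace ℝ (Fin 5)) N] [IsManifold (𝓡 5) ∞ N] (g : Bundle.ContMDiffRiemannianMetric (𝓡 5) ∞ (EuclideanSpace ℝ (Fin 5)) (TangentSpace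 (𝓡 5) : N → Type _)) [(Literature.Geometry.Lorentzian.PseudoRiemannianMetric.ofRiemannian g).HasLeviCivita], (∀ x, (Literature.Geometry.Lorentzian.PseudoRiemannianMetric.ofRiemannian g).ricci x = (-4 : ℝ) • (Literature.Geometry.Lorentzian.PseudoRiemannianMetric.ofRiemannian g).toBilinForm x) → (∃ (X : Type) (_ : TopologicalSpace X) (_ : T2Space X) (_ : SecondCountableTopology X) (_ : ChartedSpace (EuclideanHalfSpace 5) X) (_ : IsManifold (𝓡∂ 5) ∞ X) (_ : CompactSpace X) (_ : ConnectedSpace X) (j : N → X) (ι : M → X) (ρ : X → ℝ) (gb : Bundle.ContMDiffRiemannianMetric (𝓡∂ 5) 2 (EuclideanSpace ℝ (Fin 5)) (TangentSpace (𝓡∂ 5) : X → Type _)), Manifold.IsSmoothEmbedding (𝓡 5) (𝓡∂ 5) ∞ j ∧ Set.range j = (𝓡∂ 5).interior X ∧ Manifold.IsSmoothEmbedding (𝓡 4) (𝓡∂ 5) ∞ ι ∧ Set.range ι = (𝓡∂ 5).boundary X ∧ ContMDiff (𝓡∂ 5) 𝓘(ℝ, ℝ) ∞ ρ ∧ (∀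 x : X, 0 ≤ ρ x) ∧ (∀ x : X, ρ x = 0 ↔ x ∈ (𝓡∂ 5).boundary X) ∧ (∀ y : M, ∃ ν : TangentSpace (𝓡∂ 5) (ι y), gb.inner (ι y) ν ν = 1 ∧ ∀ v : TangentSpace (𝓡∂ 5) (ι y), gb.inner (ι y) ν v = mfderiv (𝓡∂ 5) 𝓘(ℝ, ℝ) ρ (ι y) v) ∧ (∀ (x : N) (v w : TangentSpace (𝓡 5) x), gb.inner (j x) (mfderiv (𝓡 5) (𝓡∂ 5) j x v) (mfderiv (𝓡 5) (𝓡∂ 5) j x w) = ρ (j x) ^ 2 * g.inner x v w) ∧ (∃ φ : M → ℝ, ∀ y : M, 0 < φ y ∧ ∀ v w : TangentSpace (𝓡 4) y, gb.inner (ι y) (mfderiv (𝓡 4) (𝓡∂ 5) ι y v) (mfderiv (𝓡 4) (𝓡∂ 5) ι y w) = φ y * g₀.inner y v w)) → (∀ (h' : Bundle.ContMDiffRiemannianMetric (𝓡 4) ∞ (EuclideanSpace ℝ (Fin 4)) (TangentSpace (𝓡 4) : M → Type _)) [(Literature.Geometry.Lorentzian.PseudoRiemannianMetric.ofRiemannian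 h').HasLeviCivita], (∃ φ : M → ℝ, ∀ x : M, 0 < φ x ∧ ∀ v w : TangentSpace (𝓡 4) x, h'.inner x v w = φ x * g₀.inner x v w) → (1 - δ) * (8 * Real.sqrt 6 * Real.pi) * Real.sqrt ((Literature.Geometry.Lorentzian.riemannianMeasure h' Set.univ).toReal) ≤ ∫ x, (Literature.Geometry.Lorentzian.PseudoRiemannianMetric.ofRiemannian h').scalarCurvature x ∂(Literature.Geometry.Lorentzian.riemannianMeasure h')) → (∀ (x : N) (X Y : TangentSpace (𝓡 5) x), g.inner x X X = 1 → g.inner x Y Y = 1 → g.inner x X Y = 0 → |(Literature.Geometry.Lorentzian.PseudoRiemannianMetric.ofRiemannian g).curvatureForm (Literature.Geometry.Lorentzian.PseudoRiemannianMetric.ofRiemannian g).leviCivita x X Y Y X + 1| ≤ ε)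

-- item stmt-SmoothPoincare4-7336 · support · rank 4 · open · by planner — informal only, no Lean statement yet:
--   [crux] InformationMetricHadamard (the gauge-theoretic heart; intended proof of crux 2
--   AhHadamardFilling; card information-metric-hadamard K1+K2; informal until
--   `asdInstantonModuliSpace`/`fisherRaoMetric` land). STATEMENT: for every smooth homotopy 4-sphere Σ
--   there is a conformal class [g] such that, for a generic representative g, the charge-one SU(2)
--   anti-self-dual moduli space M₁(Σ,g) (a smooth non-empty 5-manifold without reducibles since H²(Σ)=0
--   — Taubes1982, FreedUhlenbeck1984 — whose only end is the Donaldson–Taubes collar Ψ : M₁^{λ₀} ≅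
--   (0,λ₀] × Σ, Donaldson1983) equipped with Hitchin's

-- item stmt-SmoothPoincare4-7372 · support · rank 5 · open · by planner — informal only, no Lean statement yet:
--   [crux] AhC1ConvexSlices (card K3 sharpened; the gauge-side way to make crux 3 C0AhRecognition
--   unnecessary for the instanton witness: with it, InformationMetricHadamard + ConvexEndRecognition +
--   HadamardConvexBoundarySphere already give Σ ≅ S⁴). STATEMENT: under Groisser–Murray's Conditions 3.0
--   (closed simply connected M with positive-definite form — here M = Σ a homotopy 4-sphere — charge
--   one, SU(2)), the C⁰ asymptotics of GroisserMurray1997 Thm 3.1, (Ψ⁻¹)*g_I ~ (128π²/5)(dλ² + g)/λ² as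
--   λ → 0, upgrade to C¹ in the model scale: the difference of the Levi-Civita connections of (Ψ⁻¹)*g_I
--   and of th

/-- item stmt-SmoothPoincare4-17929 · support · rank 9 · open · by planner
why it might fail: True (smooth boundary collar + mollified ḡ-unit-normal shear + first-order asymptotics); the only risk is formal — Mathlib manifolds-with-boundary collar calculus — and is being discharged by lead c7 (StubCompactificationCollarAux landed 2026-08-17T04:25Z).
sources: Hirsch1976, ChruscielEtAl2005, GroisserMurray1997
[support] piece X₄ (true collar lemma, OWNED by the live line einstein-bulk-transfer of stmt-6014,
lead c7's φ-free statement verbatim; its registered stub `stub_compactificationCollar` with ten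
landed helper theorems proves exactly this): the C² conformal-compactification package of a complete
(N⁵, g) over a closed (M⁴, g₀) makes N connected and yields c, κ₀ > 0 and a smooth injective end
collar Φ : M × (0,1) → N with co-compact far parts on which g is C⁰-conical over κ₀·g₀. Closing it:
one line from the lead's landed theorem. [difficulty: L (Lean: XL, in progress)] — why it might
fail: True (smooth boundary collar + mollified ḡ-unit-normal shear + first-order asymptotics); the
only risk is formal — Mathlib manifolds-with-boundary collar calculus — and is being discharged by
lead c7 (StubCompactificationCollarAux landed 2026-08-17T04:25Z). — sources: Hirsch1976,
ChruscielEtAl2005, GroisserMurray1997 -/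
@[route_item "route-SmoothPoincare4-InformationMetricHadamard"]
def CompactificationCollar : Prop :=
  ∀ (M : Type) [TopologicalSpace M] [T2Space M] [SecondCountableTopology M] [ChartedSpace (EuclideanSpace ℝ (Fin 4)) M] [IsManifold (𝓡 4) ∞ M] [CompactSpace M] (g₀ : Bundle.ContMDiffRiemannianMetric (𝓡 4) ∞ (EuclideanSpace ℝ (Fin 4)) (TangentSpace (𝓡 4) : M → Type _)) (N : Type) [TopologicalSpace N] [T2Space N] [SecondCountableTopology N] [ChartedSpace (EuclideanSpace ℝ (Fin 5)) N] [IsManifold (𝓡 5) ∞ N] (g : Bundle.ContMDiffRiemannianMetric (𝓡 5) ∞ (EuclideanSpace ℝ (Fin 5)) (TangentSpace (𝓡 5) : N → Type _)), (∃ (X : Type) (_ : TopologicalSpace X) (_ : T2Space X) (_ : SecondCountableTopology X) (_ : ChartedSpace (EuclideanHalfSpace 5) X) (_ : IsManifold (𝓡∂ 5) ∞ X) (_ : CompactSpace X) (_ : ConnectedSpace X) (j : N → X) (ι : M → X) (ρ : X → ℝ) (gb : Bundle.ContMDiffRiemannianMetric (𝓡∂ 5) 2 (EuclideanSpace ℝ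 (Fin 5)) (TangentSpace (𝓡∂ 5) : X → Type _)), Manifold.IsSmoothEmbedding (𝓡 5) (𝓡∂ 5) ∞ j ∧ Set.range j = (𝓡∂ 5).interior X ∧ Manifold.IsSmoothEmbedding (𝓡 4) (𝓡∂ 5) ∞ ι ∧ Set.range ι = (𝓡∂ 5).boundary X ∧ ContMDiff (𝓡∂ 5) 𝓘(ℝ, ℝ) ∞ ρ ∧ (∀ x : X, 0 ≤ ρ x) ∧ (∀ x : X, ρ x = 0 ↔ x ∈ (𝓡∂ 5).boundary X) ∧ (∀ y : M, ∃ ν : TangentSpace (𝓡∂ 5) (ι y), gb.inner (ι y) ν ν = 1 ∧ ∀ v : TangentSpace (𝓡∂ 5) (ι y), gb.inner (ι y) ν v = mfderiv (𝓡∂ 5) 𝓘(ℝ, ℝ) ρ (ι y) v) ∧ (∀ (x : N) (v w : TangentSpace (𝓡 5) x), gb.inner (j x) (mfderiv (𝓡 5) (𝓡∂ 5) j x v) (mfderiv (𝓡 5) (𝓡∂ 5) j x w) = ρ (j x) ^ 2 * g.inner x v w) ∧ (∃ φ : M → ℝ, ∀ y : M, 0 < φ y ∧ ∀ v w : TangentSpace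 (𝓡 4) y, gb.inner (ι y) (mfderiv (𝓡 4) (𝓡∂ 5) ι y v) (mfderiv (𝓡 4) (𝓡∂ 5) ι y w) = φ y * g₀.inner y v w)) → ConnectedSpace N ∧ ∃ (c κ₀ : ℝ) (Φ : M × ℝ → N), 0 < c ∧ 0 < κ₀ ∧ ContMDiffOn ((𝓡 4).prod 𝓘(ℝ, ℝ)) (𝓡 5) ∞ Φ (univ ×ˢ Ioo (0 : ℝ) 1) ∧ InjOn Φ (univ ×ˢ Ioo (0 : ℝ) 1) ∧ (∀ t ∈ Ioo (0 : ℝ) 1, IsCompact (Φ '' (univ ×ˢ Ioo (0 : ℝ) t))ᶜ) ∧ (∀ ε : ℝ, 0 < ε → ∃ t ∈ Ioo (0 : ℝ) 1, ∀ (x : M) (l : ℝ), l ∈ Ioo (0 : ℝ) t → ∀ (v : TangentSpace (𝓡 4) x) (s : ℝ), |g.inner (Φ (x, l)) (mfderiv ((𝓡 4).prod 𝓘(ℝ, ℝ)) (𝓡 5) Φ (x, l) (v, s)) (mfderiv ((𝓡 4).prod 𝓘(ℝ, ℝ)) (𝓡 5) Φ (x, l) (v, s)) - c * (s ^ 2 +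 κ₀ * g₀.inner x v v) / l ^ 2| ≤ ε * (c * (s ^ 2 + κ₀ * g₀.inner x v v) / l ^ 2))

/-- item stmt-SmoothPoincare4-17931 · support · rank 9 · open · by planner
sources: LiQingShi2017, GroisserMurray1997
[support] GLUE of the BC2 redirect (typed split) of the RESTATED crux AhHadamardFilling
(stmt-SmoothPoincare4-6014) into its four pieces X₁ YamabeExtremalSpheres (7998) ∧ X₂
PEFillNearRound (7997) ∧ X₃ YamabePinchedEinsteinBulk (7996) ∧ X₄ CompactificationCollar (17929).
PROVED sorry-free:
`Summit.SmoothPoincare4.SmoothPoincare4.Theorems.AhHadamardFillingSplit.ahHadamardFilling_of_pieces`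
in Cruxes/AhHadamardFilling/Lines/einstein_bulk_transfer_split.lean (commit 9609b6f10708; lean check
rc 0, axioms propext/Classical.choice/Quot.sound; lands on p124840
ahHadamardFilling_of_connectedCollarFillings, NOT on SmoothPoincare4). A prover closes this item by
landing that file verbatim under Theorems/ plus `theorem ahHadamardFillingOfPieces_proof :
InformationMetricHadamard.AhHadamardFillingOfPieces :=
Theorems.AhHadamardFillingSplit.ahHadamardFilling_of_pieces` (bare-term rendering pre-flighted rc
0). Formal `route edit --split AhHadamardFilling --into … --glue-by …` bounced only on the
final-cycle rule; the tenure planner re-files it then (children re-attach by normalised signature).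
[difficulty: provable-now] — sources: LiQingShi2017, GroisserMurray1997 -/
@[route_item "route-SmoothPoincare4-InformationMetricHadamard"]
def AhHadamardFillingOfPieces : Prop :=
  YamabeExtremalSpheres → PEFillNearRound → YamabePinchedEinsteinBulk → CompactificationCollar → AhHadamardFilling

/-- item stmt-SmoothPoincare4-6016 · support · rank 9 · closed · proved by Summit.SmoothPoincare4.SmoothPoincare4.Theorems.hadamardConvexBoundarySphere_proof @ 7c31a3b0725b (prover) · by planner
sources: LeeRiemannianManifolds2018, EberleinOneill1973
[support] recognition engine (Cartan–Hadamard + convexity, a theorem to be formalised): in a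
complete simply connected Riemannian 5-manifold with sectional curvature ≤ 0, a compact set C with
nonempty interior which is convex (betweenness form: d(p,m) + d(m,q) = d(p,q) with p, q ∈ C forces m
∈ C — equivalent to geodesic convexity since geodesics are unique) and whose frontier is the image
of an injective immersion of a compact smooth 4-manifold N, has N ≅ S⁴. Proof: exp_o from an
interior point o is a diffeomorphism (Lee Thm 12.8/Prop 12.9); each ray from o leaves C exactly once
(convexity + compactness) and transversally (C lies on one side of its smooth frontier; a tangential
exit direction would put interior points on both sides), so radial projection frontier C → unit
sphere of T_oW is a bijective local diffeomorphism of compact 4-manifolds. [difficulty: L] -/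
@[route_item "route-SmoothPoincare4-InformationMetricHadamard"]
def HadamardConvexBoundarySphere : Prop :=
  ∀ (W : Type) [TopologicalSpace W] [T2Space W] [SecondCountableTopology W] [ChartedSpace (EuclideanSpace ℝ (Fin 5)) W] [IsManifold (𝓡 5) ∞ W] [SimplyConnectedSpace W] (G : Literature.Geometry.Lorentzian.PseudoRiemannianMetric (𝓡 5) ∞ (EuclideanSpace ℝ (Fin 5)) (TangentSpace (𝓡 5) : W → Type _)) (hG : G.IsRiemannian), (∀ (x : W) (r : NNReal), IsCompact {y : W | G.edist hG x y ≤ r}) → (∀ cov, G.IsLeviCivita cov → ∀ (x : W) (X Y : TangentSpace (𝓡 5) x), G.sectionalCurvature cov x X Y ≤ 0) → ∀ (C : Set W), IsCompact C → (interior C).Nonempty → (∀ p ∈ C, ∀ q ∈ C, ∀ m : W, G.edist hG p m + G.edist hG m q = G.edist hG p q → m ∈ C) → ∀ (N : Type) [TopologicalSpace N] [T2Space N] [SecondCountableTopology N] [CompactSpace N] [ChartedSpace (EuclideanSpace ℝ (Fin 4)) N] [IsManifold (𝓡 4) ∞ N] (j : N → W), ContMDiff (𝓡 4) (𝓡 5)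 ∞ j → Function.Injective j → (∀ x : N, Function.Injective (mfderiv (𝓡 4) (𝓡 5) j x)) → Set.range j = frontier C → Nonempty (N ≃ₘ⟮𝓡 4, 𝓡 4⟯ Metric.sphere (0 : EuclideanSpace ℝ (Fin 5)) 1)

/-- item stmt-SmoothPoincare4-6017 · support · rank 9 · closed · proved by Summit.SmoothPoincare4.SmoothPoincare4.Theorems.convexEndRecognition_proof @ a96fcafc70eb (prover) · by planner
sources: LeeRiemannianManifolds2018, GroisserMurray1997
[support] the convex-slice form of crux 3, provable from HadamardConvexBoundarySphere by bookkeeping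
(it is the glue of the foreseen split of crux 3 and the landing point of the gauge-side C¹ upgrade
AhC1ConvexSlices): if Σ is the cross-section of a proper smooth injective immersive end collar Φ of
a Cartan–Hadamard 5-manifold and for some t the complement K_t of the far collar Φ(Σ × (0,t)) has
nonempty interior and is convex, then Σ ≅ S⁴ (frontier K_t = Φ(Σ × {t}) ≅ Σ by the closure condition
on the collar). [difficulty: M] -/
@[route_item "route-SmoothPoincare4-InformationMetricHadamard"]
def ConvexEndRecognition : Prop :=
  ∀ (S : Literature.Topology.FourManifolds.HomotopySphere 4) (W : Type) [TopologicalSpace W] [T2Space W] [SecondCountableTopology W] [ChartedSpace (EuclideanSpace ℝ (Fin 5)) W] [IsManifold (𝓡 5) ∞ W] [SimplyConnectedSpace W] (G : Literature.Geometry.Lorentzian.PseudoRiemannianMetric (𝓡 5) ∞ (EuclideanSpace ℝ (Fin 5)) (TangentSpace (𝓡 5) : W → Type _)) (hG : G.IsRiemannian) (Φ : S.carrier × ℝ → W), (∀ (x : W) (r : NNReal), IsCompact {y : W | G.edist hG x y ≤ r}) → (∀ cov, G.IsLeviCivita cov → ∀ (x : W) (X Y : TangentSpace (𝓡 5) x),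 G.sectionalCurvature cov x X Y ≤ 0) → ContMDiffOn ((𝓡 4).prod 𝓘(ℝ, ℝ)) (𝓡 5) ∞ Φ (Set.univ ×ˢ Set.Ioo (0 : ℝ) 1) → Set.InjOn Φ (Set.univ ×ˢ Set.Ioo (0 : ℝ) 1) → (∀ p ∈ Set.univ ×ˢ Set.Ioo (0 : ℝ) 1, Function.Injective (mfderiv ((𝓡 4).prod 𝓘(ℝ, ℝ)) (𝓡 5) Φ p)) → (∀ t ∈ Set.Ioo (0 : ℝ) 1, IsCompact (Φ '' (Set.univ ×ˢ Set.Ioo (0 : ℝ) t))ᶜ) → (∀ t ∈ Set.Ioo (0 : ℝ) 1, closure (Φ '' (Set.univ ×ˢ Set.Ioo (0 : ℝ) t)) ⊆ Φ '' (Set.univ ×ˢ Set.Ioo (0 : ℝ) 1)) → (∃ t ∈ Set.Ioo (0 : ℝ) 1, (interior (Φ '' (Set.univ ×ˢ Set.Ioo (0 : ℝ) t))ᶜ).Nonempty ∧ ∀ p ∈ (Φ '' (Set.univ ×ˢ Set.Ioo (0 : ℝ) t))ᶜ, ∀ q ∈ (Φ '' (Set.univ ×ˢ Set.Ioo (0 :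 ℝ) t))ᶜ, ∀ m : W, G.edist hG p m + G.edist hG m q = G.edist hG p q → m ∈ (Φ '' (Set.univ ×ˢ Set.Ioo (0 : ℝ) t))ᶜ) → Nonempty (S.carrier ≃ₘ⟮𝓡 4, 𝓡 4⟯ Metric.sphere (0 : EuclideanSpace ℝ (Fin 5)) 1)

/-- item stmt-SmoothPoincare4-6018 · assembly · rank 1 · closed · proved by Summit.SmoothPoincare4.SmoothPoincare4.Theorems.InformationMetricHadamard_Assembly_proof (prover) · by planner
sources: GroisserMurray1997, Hatcher2002
[assembly] C0AhRecognition → AhHadamardFilling → SmoothPoincare4. -/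
@[route_item "route-SmoothPoincare4-InformationMetricHadamard"]
def Assembly : Prop :=
  C0AhRecognition → AhHadamardFilling → SmoothPoincare4

/-! D-0027 §2.1 — DECIDING THEOREM (planner-authored via `route open/edit --closes-file`; by planner-rbadge-SmoothPoincare4-InformationMetr-d6775858-g4-0 2026-08-15T16:12:01Z):
its hypotheses are this route's items and its conclusion the sub-problem Statement (glue_lint), and it elaborates with this file. -/

@[closes "route-SmoothPoincare4-InformationMetricHadamard"] theorem closes (hR : C0AhRecognition) (hF : AhHadamardFilling) :
    _root_.SmoothPoincare4 := by
  unfold _root_.SmoothPoincare4 Literature.SPC4.SmoothPoincareConjectureFour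
    ContinuousMap.HomotopyEquiv.NonemptyDiffeomorphSphere
  intro M _ _ _ _ _ e
  haveI : CompactSpace M :=
    Literature.Topology.FourManifolds.compactSpace_of_homotopyEquiv_sphere_four_holds M e
  obtain ⟨o⟩ :=
    Literature.Topology.FourManifolds.isOrientable_of_homotopyEquiv_sphere_four_holds M e
  have hF' := hF
  unfold AhHadamardFilling at hF'
  obtain ⟨g, hg, W, _i1, _i2, _i3, _i4, _i5, _i6, G, hG, c, Φ, hc, hcpt, hsec, hsm, hinj, hco, hcl,
    hasym⟩ := hF' ⟨M, o, ⟨e⟩⟩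
  have hR' := hR
  unfold C0AhRecognition at hR'
  exact hR' ⟨M, o, ⟨e⟩⟩ g hg W G hG c Φ hc hcpt hsec hsm hinj hco hcl hasym

end Summit.SmoothPoincare4.SmoothPoincare4.Theses.InformationMetricHadamard
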